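import Summits.QuantumFields.YangMills.Theorems.UnitScaleTiltProp8HalvingQuarterCubeSeq
import Summits.QuantumFields.YangMills.Theorems.UnitScaleTiltProp8FlatPullbackDictionary
import Literature.MathematicalPhysics.QuantumFieldTheory.Balaban1983to89.B8Eq12HodgeLaplacianV1
import Mathlib.Analysis.Normed.Module.DoubleDual
import HarnessLib

/-!
# Route `UnitScaleTilt`, crux K1 child «MinimiserStabilityRegPr» (stmt-QuantumFields-19200), registered stub V2′ `stub_halvingStep`
# (skeletons v8 5b4e846794b80374 / v9 pen) — **[Balaban1985Variational] (164) FOR THE `𝔤`-VALUED DATUM, WITHOUT COMPONENT LOSS, IN THE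
# THREE LETTERS OF [Balaban1985RegularSpaces] (1.140) THAT THE LAST MILE CONSUMES**: the matrix-valued field `𝔄 = HB` (print's `HB`, `B(c) ∈ 𝔤`,
# `H` the real P2 operator acting through its kernel `𝔄(b) = Σ_c (He_c)(b)·B(c)`) obeys `‖𝔄(b)‖, Lᵏ‖𝔄(b + e_κ) − 𝔄(b)‖, ‖(∂^{η*}∂^η𝔄♯)_μ(z)‖ ≤
# ¼M_Δ max{4CB₀B₃ε₁, ½ε₀}` — exactly the sup, gradient and second-order members `h1`/`h2`/`h3` of w3 g0's `Prop8PullbackDict.localChart_top_of_torus`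
# for the `HB`-summand of (159) — from the REAL (164) of `HalvingQuarterCubeSeq.rows164_quarter_cubeSeqMT3_top` applied to every real functional of
# the datum (duality `‖M‖ = sup_{‖f‖≤1}|f(M)|`), and the FLAT STENCIL DICTIONARY `(∂^{η*}∂^η𝔄♯)_μ(z) ↔ (∂*∂𝔄)(⟨z, μ⟩)` (F2's `pdiv ∘ plaqCovDeriv ∘ pull` = P2's
# `dcsE ∘ dcE`, componentwise)

Cell `ym3-torus` (HUMAN RULING D-0037, YM ladder rung R3 — continuum SU(2) YM₃ on the torus is a RUNG, not the Clay problem), width seat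
`ym-ust-19200-w3` gen 2 (D-0149).  `--supports stmt-QuantumFields-19200 --as helper`; def-free, 0 sorry, standard axioms.  Companion of
`HalvingQuarterCubeSeq` (p591896), `HalvingDatum160` (p592665), `HalvingQuarterL5`.

WHY.  Print's datum `B(c) = (1/i) log V₁(c)` is `𝔤 = 𝔰𝔲(2)`-valued and `H` acts componentwise; bounding the three components separately and
re-assembling the matrix costs a factor `√3` in `‖HB‖`, which the halving CANNOT afford (`3α₂ < m` with `α₂ ≥ ¼m·√3` fails).  The lossless route:
for every real functional `g` with `|g(M)| ≤ ‖M‖`, `g ∘ 𝔄 = H(g ∘ B)` is a REAL datum of the same near/far sizes, so the real (164) bounds `|g(𝔄(b))|`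
uniformly in `g`, and `‖𝔄(b)‖ = sup_g |g(𝔄(b))|` (Hahn–Banach through the complex dual and a phase rotation).  The second-order letter needs in
addition that F2's `ℤᵈ`-stencil `pdiv η 1 (plaqCovDeriv η 1 A♯)` IS P2's torus stencil `dcsE η⁻¹ (dcE η⁻¹ A)` under the periodic pullback
(`B10Eq27TorusAxialLog.pull`), real component by real component — pure finite-difference bookkeeping ([Balaban1985RegularSpaces] (1.1)–(1.2),
[Balaban1984PropagatorsII] (2.5), (2.19)), the pullback twin of pub-ymgap's `B8CubeMemberTorusChart.dcsE_dcE_liftB`.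

WHAT THIS FILE PROVES (no definition, no sorry):
* §1 `norm_le_of_forall_reFunctional` — DUALITY: in a complex normed space, if `g(x) ≤ q` for every function `g = (y ↦ r·Re(u·f(y)))` built from a
  continuous `ℂ`-linear functional `f`, `u ∈ ℂ`, `r ∈ ℝ` with `|g(y)| ≤ ‖y‖` for all `y`, then `‖x‖ ≤ q` (`NormedSpace.norm_le_dual_bound` + phase rotation).
* §2 **`re_pdiv_plaqCovDeriv_pull`** — THE FLAT STENCIL DICTIONARY: for every such `g` (indeed every additive real-homogeneous `g`) and every
  matrix-valued torus field `𝔄`, `g((∂^{η*}∂^η𝔄♯)_μ(z)) = (dcsE η⁻¹ (dcE η⁻¹ (g ∘ 𝔄)))(⟨0 + z, μ⟩)` (`pdiv_flat_apply`, `plaqCovDeriv_flat_pull_apply`,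
  `B8Eq12HodgeLaplacianV1.dcsE_apply`, `LatticeFieldCalculus.curl`/`pdiffAdj`, `transl_add_e`/`transl_sub_e`).
* §3 `reFunctional_kernel` — for `𝔄(b) = Σ_c (He_c)(b)·B(c)` (kernel representation; `e_c` the indicator) and `g` as in §1: `g(𝔄(b)) = (H(g ∘ B))(b)`;
  **`matrixRows164_quarter_top`** — (164) FOR THE `𝔤`-VALUED DATUM at the cube sequence `cubeSeqMT3 F n K x₀ ρ S M`: under the hypotheses of
  `HalvingQuarterCubeSeq.rows164_quarter_cubeSeqMT3_top` with the near/far sizes stated for `‖B(c)‖`, at every fine bond `b` within `r₀` blocks of the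
  centre: `‖𝔄(b)‖ ≤ q`, `Lᵏ‖𝔄(⟨b₋ + e_κ, b_dir⟩) − 𝔄(b)‖ ≤ q` (all `κ`), and `‖pdiv η 1 (plaqCovDeriv η 1 (pull 𝔄 0)) μ z‖ ≤ q` at `b = ⟨0 + z, μ⟩`
  (`η = L^{−k}`), `q = ¼M_Δ max{4CB₀B₃ε₁, ½ε₀}` — the `h1`/`h2`/`h3` letters of `localChart_top_of_torus` for the `HB`-summand.
HONEST SCOPE: bookkeeping over the real (164); the sizes (160)/(155), the P2 letters and the identification of print's `HB` with the kernel sum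
are hypotheses.  NOT a claim about the crux, the rung, or the mass gap.

References: T. Bałaban, CMP **102** (1985) 277–309 [Balaban1985Variational] (159)–(161) p.303, (164)–(165) p.304; CMP **99** (1985) 75–102
[Balaban1985RegularSpaces] (1.1)–(1.2) p.76, (1.140) p.100; CMP **96** (1984) 223–250 [Balaban1984PropagatorsII] (2.5) p.224, (2.19) p.226.
-/

set_option autoImplicit false

noncomputable section

open scoped BigOperators Matrix.Norms.L2Operator

namespace Summit.QuantumFields.YangMills.Theorems.HalvingQuarterMatrix

open Literature.MathematicalPhysics.QuantumFieldTheory.Balaban1983to89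
open B5Eq117TorusCarriers (Mk)
open B5Eq118OneStroke (iterBlockOf)
open B5Prop12FieldsLattice (distSite)
open B6SectADomainsV1 (Domains)
open B6SectAOperatorsV1 (BondIdx dcE dcsE dcE_apply)
open B8Eq12HodgeLaplacianV1 (dcsE_apply)
open B8Eq143PlaqExpansion (pdiv)
open B8Eq146AExpansion (plaqCovDeriv)
open B10Eq27TorusAxialLog (pull transl transl_add_e transl_sub_e pull_apply)
open B7Prop1Explicit (e)
open LatticeFieldCalculus (curl pdiffAdj)
open T3ContinuumYM3Torus (T3Family)
open FlatCubeOpsText (distBI IsLevWeight HDecayLetterD RowSum162)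
open FlatCubeSequenceAligned (cubeSeqMT3)
open Prop8PullbackDict (pdiv_flat_apply plaqCovDeriv_flat_pull_apply)
open HalvingQuarterCubeSeq (rows164_quarter_cubeSeqMT3_top)

/-! ## §1 Duality: the norm from the real functionals `y ↦ r·Re(u·f(y))` -/

section Duality

variable {E : Type*} [NormedAddCommGroup E] [NormedSpace ℂ E]

/-- **DUALITY WITH A PHASE ROTATION**: if every real functional of the form `g(y) = r·Re(u·f(y))` (`f` a continuous `ℂ`-linear functional, `u ∈ ℂ`, `r ∈ ℝ`)
that is dominated by the norm (`|g(y)| ≤ ‖y‖`) satisfies `g(x) ≤ q`, and `0 ≤ q`, then `‖x‖ ≤ q` (the complex Hahn–Banach bound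
`NormedSpace.norm_le_dual_bound`, the phase of `f(x)` rotated away). [folklore] -/
theorem norm_le_of_forall_reFunctional (x : E) {q : ℝ} (hq : 0 ≤ q)
    (h : ∀ (f : StrongDual ℂ E) (u : ℂ) (r : ℝ), (∀ y : E, |r * (u * f y).re| ≤ ‖y‖) → r * (u * f x).re ≤ q) : ‖x‖ ≤ q := by
  refine NormedSpace.norm_le_dual_bound ℂ x hq fun f => ?_
  by_cases hw : f x = 0
  · rw [hw, norm_zero]; positivity
  · have hwpos : 0 < ‖f x‖ := norm_pos_iff.mpr hw
    have hfpos : 0 < ‖f‖ := by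
      rcases (norm_nonneg f).lt_or_eq with h | h
      · exact h
      · exfalso
        have := f.le_opNorm x
        rw [← h, zero_mul] at this
        exact hw (norm_le_zero_iff.mp this)
    -- the rotated, normalised functional `g(y) = Re(conj(f x)·f(y)) / (‖f x‖·‖f‖)`
    have hdom : ∀ y : E, |(‖f x‖ * ‖f‖)⁻¹ * (star (f x) * f y).re| ≤ ‖y‖ := by
      intro y
      rw [abs_mul, abs_inv, abs_of_pos (mul_pos hwpos hfpos)]
      have h1 : |(star (f x) * f y).re| ≤ ‖f x‖ * (‖f‖ * ‖y‖) :=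
        calc |(star (f x) * f y).re| ≤ ‖star (f x) * f y‖ := Complex.abs_re_le_norm _
          _ = ‖f x‖ * ‖f y‖ := by rw [norm_mul, norm_star]
          _ ≤ ‖f x‖ * (‖f‖ * ‖y‖) := mul_le_mul_of_nonneg_left (f.le_opNorm y) hwpos.le
      calc (‖f x‖ * ‖f‖)⁻¹ * |(star (f x) * f y).re| ≤ (‖f x‖ * ‖f‖)⁻¹ * (‖f x‖ * (‖f‖ * ‖y‖)) :=
            mul_le_mul_of_nonneg_left h1 (by positivity)
        _ = ‖y‖ := by field_simp
    have hval : (‖f x‖ * ‖f‖)⁻¹ * (star (f x) * f x).re = ‖f x‖ / ‖f‖ := by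
      have h2 : (star (f x) * f x).re = ‖f x‖ ^ 2 := by
        rw [Complex.star_def, Complex.conj_mul', ← Complex.ofReal_pow, Complex.ofReal_re]
      rw [h2]
      field_simp
    have hg := h f (star (f x)) ((‖f x‖ * ‖f‖)⁻¹) hdom
    rw [hval, div_le_iff₀ hfpos] at hg
    exact hg

end Duality

/-! ## §2 The flat stencil dictionary: F2's `pdiv ∘ plaqCovDeriv ∘ pull` is P2's `dcsE ∘ dcE`, componentwise -/

section Stencil

variable {P : Params} {N : ℕ}

/-- `Σ_{ν ∈ Iio μ} = Σ_ν 𝟙(ν < μ)·`. [folklore] -/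
private theorem sum_Iio_eq_sum_ite {M : Type*} [AddCommMonoid M] (μ : Fin P.d) (G : Fin P.d → M) :
    ∑ ν ∈ Finset.Iio μ, G ν = ∑ ν, if ν < μ then G ν else 0 := by
  rw [← Finset.sum_filter]
  congr 1
  ext ν
  simp

/-- `Σ_{ν ∈ Ioi μ} = Σ_ν 𝟙(μ < ν)·`. [folklore] -/
private theorem sum_Ioi_eq_sum_ite {M : Type*} [AddCommMonoid M] (μ : Fin P.d) (G : Fin P.d → M) :
    ∑ ν ∈ Finset.Ioi μ, G ν = ∑ ν, if μ < ν then G ν else 0 := by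
  rw [← Finset.sum_filter]
  congr 1
  ext ν
  simp

/-- **THE FLAT STENCIL DICTIONARY** `(∂^{η*}∂^η𝔄♯)_μ(z) ↔ (∂*∂𝔄)(⟨0 + z, μ⟩)`: for every additive, real-homogeneous scalar reading `g` of the matrices
(here: `g(M) = r·Re(u·f(M))`) and every matrix-valued torus field `𝔄`, F2's second-order letter of the periodic pullback read through `g` IS P2's
`dcsE η⁻¹ (dcE η⁻¹ ·)` of the real bond function `g ∘ 𝔄` at the torus bond `⟨0 + z, μ⟩` — both are
`Σ_{ν<μ} ∂*_ν(∂𝔄)_{νμ} − Σ_{ν>μ} ∂*_ν(∂𝔄)_{μν}` with `∂*_νF(y) = η⁻¹(F(y − e_ν) − F(y))`, `(∂𝔄)_{μν}(y) = η⁻¹(𝔄⟨y+e_μ,ν⟩ − 𝔄⟨y,ν⟩ − 𝔄⟨y+e_ν,μ⟩ + 𝔄⟨y,μ⟩)`.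
[cite: Balaban1985RegularSpaces, (1.1)-(1.2) p.76; Balaban1984PropagatorsII, (2.5) p.224, (2.19) p.226] -/
theorem re_pdiv_plaqCovDeriv_pull (η : ℝ) (f : StrongDual ℂ (Matrix (Fin N) (Fin N) ℂ)) (u : ℂ) (r : ℝ)
    (𝔄 : PBond P 0 → Matrix (Fin N) (Fin N) ℂ) (μ : Fin P.d) (z : B7Prop1Explicit.Site P.d) :
    r * (u * f (pdiv η (1 : B7Prop1Explicit.Site P.d → Fin P.d → (Matrix (Fin N) (Fin N) ℂ)ˣ)
        (plaqCovDeriv η (1 : B7Prop1Explicit.Site P.d → Fin P.d → (Matrix (Fin N) (Fin N) ℂ)ˣ) (pull 𝔄 0)) μ z)).re =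
      dcsE η⁻¹ (dcE η⁻¹ (WithLp.toLp 2 (fun b : PBond P 0 => r * (u * f (𝔄 b)).re))) ⟨transl 0 z, μ⟩ := by
  -- the scalar reading is additive and real-homogeneous
  set g : Matrix (Fin N) (Fin N) ℂ → ℝ := fun M => r * (u * f M).re with hg
  have g_sub : ∀ A B : Matrix (Fin N) (Fin N) ℂ, g (A - B) = g A - g B := by
    intro A B; simp only [hg, map_sub, mul_sub, Complex.sub_re]
  have g_smul : ∀ (s : ℝ) (A : Matrix (Fin N) (Fin N) ℂ), g (s • A) = s * g A := by
    intro s A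
    simp only [hg]
    rw [ContinuousLinearMap.map_smul_of_tower, Complex.real_smul, mul_left_comm u, Complex.re_ofReal_mul]
    ring
  have g_sum : ∀ (s : Finset (Fin P.d)) (G : Fin P.d → Matrix (Fin N) (Fin N) ℂ), g (∑ ν ∈ s, G ν) = ∑ ν ∈ s, g (G ν) := by
    intro s G
    simp only [hg, map_sum, Finset.mul_sum, Complex.re_sum]
  have g_zero : g 0 = 0 := by simp [hg]
  show g _ = _
  rw [pdiv_flat_apply, g_sub, g_sum, g_sum, sum_Iio_eq_sum_ite, sum_Ioi_eq_sum_ite, dcsE_apply]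
  congr 1
  · refine Finset.sum_congr rfl fun ν _ => ?_
    split_ifs with h
    · rw [g_smul, g_sub, plaqCovDeriv_flat_pull_apply, plaqCovDeriv_flat_pull_apply, g_sub, g_sub, g_smul, g_smul, g_smul, g_smul,
        g_sub, g_sub, g_sub, g_sub]
      simp only [pdiffAdj, dcE_apply, curl, transl_sub_e, smul_eq_mul, hg]
      ring
    · rfl
  · refine Finset.sum_congr rfl fun ν _ => ?_
    split_ifs with h
    · rw [g_smul, g_sub, plaqCovDeriv_flat_pull_apply, plaqCovDeriv_flat_pull_apply, g_sub, g_sub, g_smul, g_smul, g_smul, g_smul,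
        g_sub, g_sub, g_sub, g_sub]
      simp only [pdiffAdj, dcE_apply, curl, transl_sub_e, smul_eq_mul, hg]
      ring
    · rfl

end Stencil

/-! ## §3 (164) for the `𝔤`-valued datum at the cube sequence -/

section Matrix164

variable {F : T3Family} {n K : ℕ}

/-- **A REAL READING OF THE KERNEL SUM IS `H` OF THE READ DATUM**: for `𝔄(b) = Σ_c (He_c)(b)·B(c)` (`e_c` the indicator of the index bond `c`) and the
reading `g(M) = r·Re(u·f(M))`: `g(𝔄(b)) = (H(g ∘ B))(b)` (linearity of `H`: `X = Σ_c X(c)e_c`). [cite: Balaban1985Variational, (161) p.303] -/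
theorem reFunctional_kernel {D : Domains (F.P K)} (H : (BondIdx D → ℝ) →ₗ[ℝ] (PBond (F.P K) 0 → ℝ))
    {B : BondIdx D → Matrix (Fin 2) (Fin 2) ℂ} {𝔄 : PBond (F.P K) 0 → Matrix (Fin 2) (Fin 2) ℂ}
    (h𝔄 : ∀ b, 𝔄 b = ∑ c, H (Pi.single c 1) b • B c)
    (f : StrongDual ℂ (Matrix (Fin 2) (Fin 2) ℂ)) (u : ℂ) (r : ℝ) (b : PBond (F.P K) 0) :
    r * (u * f (𝔄 b)).re = H (fun c => r * (u * f (B c)).re) b := by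
  -- the datum expanded in the indicator basis, and `H` applied
  have hX : (fun c => r * (u * f (B c)).re) = ∑ c, (r * (u * f (B c)).re) • (Pi.single c (1 : ℝ) : BondIdx D → ℝ) := by
    funext c'
    rw [Finset.sum_apply, Finset.sum_eq_single c' (fun c _ hc => by simp [Ne.symm hc]) (fun h => absurd (Finset.mem_univ _) h)]
    simp
  have hR : H (fun c => r * (u * f (B c)).re) b = ∑ c, (r * (u * f (B c)).re) * H (Pi.single c 1) b := by
    rw [hX, map_sum, Finset.sum_apply]
    refine Finset.sum_congr rfl fun c _ => ?_
    rw [LinearMap.map_smul, Pi.smul_apply, smul_eq_mul]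
  -- the functional applied to the kernel sum
  have hL : f (𝔄 b) = ∑ c, ((H (Pi.single c 1) b : ℝ) : ℂ) * f (B c) := by
    rw [h𝔄 b, map_sum]
    refine Finset.sum_congr rfl fun c _ => ?_
    rw [ContinuousLinearMap.map_smul_of_tower, Complex.real_smul]
  rw [hR, hL, Finset.mul_sum, Complex.re_sum, Finset.mul_sum]
  refine Finset.sum_congr rfl fun c _ => ?_
  rw [mul_left_comm u, Complex.re_ofReal_mul]
  ring

/-- **(164) FOR THE `𝔤`-VALUED DATUM — THE `h1`/`h2`/`h3` LETTERS OF THE `HB`-SUMMAND** (for `Prop8PullbackDict.localChart_top_of_torus`): at the cube sequence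
`D := cubeSeqMT3 F n K x₀ ρ S M`, for the P2 letters of a real linear `H` over `dBI ≥ distBI`, (163), `R₁M₁ ≤ ρ − r₀ − 1`, a matrix-valued datum `B` of NEAR size
`‖B(c)‖ ≤ C·M_Δ·ε₁·(distBI(b,c) + 1)` on the top level and FAR size `‖B(c)‖ ≤ C·M_Δ·ε₀·L^{k−j(c)}` below, and the matrix field `𝔄(b) = Σ_c (He_c)(b)·B(c)`:
at every fine bond `b` whose `k`-block is within `r₀` of the centre block, with `q = ¼M_Δ max{4CB₀B₃ε₁, ½ε₀}`:
`‖𝔄(b)‖ ≤ q`, `Lᵏ‖𝔄(⟨b₋ + e_κ, dir b⟩) − 𝔄(b)‖ ≤ q`, and, when `b = ⟨0 + z, μ⟩`, `‖(∂^{η*}∂^η𝔄♯)_μ(z)‖ ≤ q` (`η = L^{−k}`, F2's letters).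
[cite: Balaban1985Variational, (160)-(164) pp.303-304, (159) p.303; Balaban1985RegularSpaces, (1.140) p.100] -/
theorem matrixRows164_quarter_top (hnK : n < K) (x₀ : Site (F.P K) 0) (ρ S M : ℕ) (hM : 1 ≤ M)
    {dBI : PBond (F.P K) 0 → BondIdx (cubeSeqMT3 F n K x₀ ρ S M hM) → ℝ} {w : ℕ → PBond (F.P K) 0 → ℝ}
    {H : (BondIdx (cubeSeqMT3 F n K x₀ ρ S M hM) → ℝ) →ₗ[ℝ] (PBond (F.P K) 0 → ℝ)} {δ₀ B₀ B₃ C MΔ ε₁ ε₀ R₁M₁ r₀ : ℝ}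
    (hw : IsLevWeight F n K (cubeSeqMT3 F n K x₀ ρ S M hM) w)
    (hdom : ∀ b c, distBI (cubeSeqMT3 F n K x₀ ρ S M hM) b c ≤ dBI b c)
    (hH : HDecayLetterD F n K (cubeSeqMT3 F n K x₀ ρ S M hM) dBI w H B₀ δ₀)
    (h162 : RowSum162 F n K (cubeSeqMT3 F n K x₀ ρ S M hM) dBI w δ₀ B₃)
    (hδ₀ : 0 ≤ δ₀) (hB₀ : 0 ≤ B₀) (hB₃ : 0 ≤ B₃) (hC : 0 ≤ C) (hMΔ : 0 ≤ MΔ) (hε₁ : 0 ≤ ε₁) (hε₀ : 0 ≤ ε₀) (hR : 0 ≤ R₁M₁)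
    (h163 : 4 * C * B₀ * B₃ * Real.exp (-(δ₀ / 2 * R₁M₁)) ≤ 1 / 2) (hρ : R₁M₁ ≤ (ρ : ℝ) - r₀ - 1)
    {B : BondIdx (cubeSeqMT3 F n K x₀ ρ S M hM) → Matrix (Fin 2) (Fin 2) ℂ} {𝔄 : PBond (F.P K) 0 → Matrix (Fin 2) (Fin 2) ℂ}
    (h𝔄 : ∀ b, 𝔄 b = ∑ c, H (Pi.single c 1) b • B c)
    {b : PBond (F.P K) 0} (hb : distSite (Mk (F.P K) (K - n)) (iterBlockOf (K - n) b.src) (iterBlockOf (K - n) x₀) ≤ r₀)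
    (hnear : ∀ c : BondIdx (cubeSeqMT3 F n K x₀ ρ S M hM), (c.1.1 : ℕ) = K - n →
      ‖B c‖ ≤ C * MΔ * ε₁ * (distBI (cubeSeqMT3 F n K x₀ ρ S M hM) b c + 1))
    (hfar : ∀ c : BondIdx (cubeSeqMT3 F n K x₀ ρ S M hM), (c.1.1 : ℕ) < K - n →
      ‖B c‖ ≤ C * MΔ * ε₀ * (F.L : ℝ) ^ ((K - n) - (c.1.1 : ℕ))) :
    ‖𝔄 b‖ ≤ 1 / 4 * MΔ * max (4 * C * B₀ * B₃ * ε₁) (ε₀ / 2) ∧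
    (∀ κ : Fin 3, (F.L : ℝ) ^ (K - n) * ‖𝔄 ⟨b.src.shift κ, b.dir⟩ - 𝔄 b‖ ≤ 1 / 4 * MΔ * max (4 * C * B₀ * B₃ * ε₁) (ε₀ / 2)) ∧
    ∀ (z : B7Prop1Explicit.Site (F.P K).d) (μ : Fin (F.P K).d), b = ⟨transl 0 z, μ⟩ →
      ‖pdiv (((F.L : ℝ)⁻¹) ^ (K - n)) (1 : B7Prop1Explicit.Site (F.P K).d → Fin (F.P K).d → (Matrix (Fin 2) (Fin 2) ℂ)ˣ)
          (plaqCovDeriv (((F.L : ℝ)⁻¹) ^ (K - n)) (1 : B7Prop1Explicit.Site (F.P K).d → Fin (F.P K).d → (Matrix (Fin 2) (Fin 2) ℂ)ˣ)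
            (pull 𝔄 0)) μ z‖ ≤ 1 / 4 * MΔ * max (4 * C * B₀ * B₃ * ε₁) (ε₀ / 2) := by
  set q : ℝ := 1 / 4 * MΔ * max (4 * C * B₀ * B₃ * ε₁) (ε₀ / 2) with hq
  have hq0 : 0 ≤ q := by
    have : 0 ≤ max (4 * C * B₀ * B₃ * ε₁) (ε₀ / 2) := le_max_of_le_right (by linarith)
    positivity
  have hLk : (0 : ℝ) < (F.L : ℝ) ^ (K - n) := by
    have : (0 : ℝ) < (F.L : ℝ) := by exact_mod_cast lt_trans zero_lt_one F.hL.2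
    positivity
  -- the real (164) for every norm-dominated reading `g`
  have key : ∀ (f : StrongDual ℂ (Matrix (Fin 2) (Fin 2) ℂ)) (u : ℂ) (r : ℝ),
      (∀ y : Matrix (Fin 2) (Fin 2) ℂ, |r * (u * f y).re| ≤ ‖y‖) →
      |H (fun c => r * (u * f (B c)).re) b| ≤ q ∧
      (∀ ν : Fin 3, (F.L : ℝ) ^ (K - n) * |H (fun c => r * (u * f (B c)).re) ⟨b.src.shift ν, b.dir⟩ - H (fun c => r * (u * f (B c)).re) b| ≤ q) ∧
      |(dcsE ((F.L : ℝ) ^ (K - n)) (dcE ((F.L : ℝ) ^ (K - n)) (WithLp.toLp 2 (H (fun c => r * (u * f (B c)).re))))) b| ≤ q := by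
    intro f u r hg
    obtain ⟨r1, r2, r3, -⟩ := rows164_quarter_cubeSeqMT3_top hnK x₀ ρ S M hM hw hdom hH h162 hδ₀ hB₀ hB₃ hC hMΔ hε₁ hε₀ hR h163 hρ
      (X := fun c => r * (u * f (B c)).re) hb
      (fun c hc => (hg (B c)).trans (hnear c hc)) (fun c hc => (hg (B c)).trans (hfar c hc))
    exact ⟨r1, r2, r3⟩
  refine ⟨?_, fun κ => ?_, fun z μ hbz => ?_⟩
  · -- h1: the sup letter by duality
    refine norm_le_of_forall_reFunctional (𝔄 b) hq0 fun f u r hg => ?_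
    rw [reFunctional_kernel H h𝔄 f u r b]
    exact le_of_abs_le (key f u r hg).1
  · -- h2: the gradient letter by duality on the difference
    have hdiff : ‖𝔄 ⟨b.src.shift κ, b.dir⟩ - 𝔄 b‖ ≤ q / (F.L : ℝ) ^ (K - n) := by
      refine norm_le_of_forall_reFunctional _ (div_nonneg hq0 hLk.le) fun f u r hg => ?_
      have hlin : r * (u * f (𝔄 ⟨b.src.shift κ, b.dir⟩ - 𝔄 b)).re =
          H (fun c => r * (u * f (B c)).re) ⟨b.src.shift κ, b.dir⟩ - H (fun c => r * (u * f (B c)).re) b := by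
        rw [map_sub, mul_sub, Complex.sub_re, mul_sub, reFunctional_kernel H h𝔄 f u r, reFunctional_kernel H h𝔄 f u r]
      have h2 := (key f u r hg).2.1 κ
      have habs : |H (fun c => r * (u * f (B c)).re) ⟨b.src.shift κ, b.dir⟩ - H (fun c => r * (u * f (B c)).re) b| ≤
          q / (F.L : ℝ) ^ (K - n) := by
        rw [le_div_iff₀ hLk, mul_comm]
        exact h2
      rw [hlin]
      exact (le_abs_self _).trans habs
    calc (F.L : ℝ) ^ (K - n) * ‖𝔄 ⟨b.src.shift κ, b.dir⟩ - 𝔄 b‖ ≤ (F.L : ℝ) ^ (K - n) * (q / (F.L : ℝ) ^ (K - n)) :=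
          mul_le_mul_of_nonneg_left hdiff hLk.le
      _ = q := mul_div_cancel₀ q hLk.ne'
  · -- h3: the second-order letter by duality and the stencil dictionary
    refine norm_le_of_forall_reFunctional _ hq0 fun f u r hg => ?_
    rw [re_pdiv_plaqCovDeriv_pull]
    have hfun : (fun b' : PBond (F.P K) 0 => r * (u * f (𝔄 b')).re) = H (fun c => r * (u * f (B c)).re) :=
      funext fun b' => reFunctional_kernel H h𝔄 f u r b'
    have hη : ((((F.L : ℝ)⁻¹) ^ (K - n))⁻¹ : ℝ) = (F.L : ℝ) ^ (K - n) := by rw [inv_pow, inv_inv]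
    rw [hfun, hη, ← hbz]
    exact le_of_abs_le (key f u r hg).2.2

end Matrix164

end Summit.QuantumFields.YangMills.Theorems.HalvingQuarterMatrix

end
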